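import Mathlib
import Summits.ValiantsHypothesis.ValiantsHypothesis.Theorems.LacunarySymmetroidMatrixDescartesCensusWindowFourRowMult

/-!
# `MatrixDescartes` census — WINDOW-4 BRIDGE: the normalised window of a sharp fewnomial has three positive roots (multiplicity form)

HONEST FRAMING.  Object-search cell `pub-symmetroid`, door-A target `DoorA26 := PosRootLawAt 2 6 19`
(stmt-ValiantsHypothesis-19979; OPEN, typed, never asserted).  Necessary-condition rows about the four-term WINDOWS of HYPOTHETICAL
Descartes-sharp fewnomials; nothing here bounds any census count, kills any cell or bears on `MatrixDescartes`
(stmt-ValiantsHypothesis-18050) / `VP ≠ VNP`.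

One bridge lemma, factored out of the proof of `window_four_left_row_core` (`…CensusWindowFourRowMult`, engine-2 g30) so that EVERY
pure-form window-4 row stated for `a − bX^u + cX^(u+v) − eX^(u+v+w)` with `a,b,c,e > 0` and `3 ≤ roots.countP (0 < ·)` (the witness rows,
the pocket rows `…CensusWindowFourPocketRows`, the secant rows) applies VERBATIM to a window `r < s < u < v` of a sharp `n`-nomial, with
`a = |c_r|·M_r`, …, `e = |c_v|·M_v` (`M_t` the absolute twist multipliers) and the gaps `U₁, V, W`:

* `window_four_core_three_le_countP` — an alternating 4-nomial `κr X^er + κs X^es + κu X^eu + κv X^ev` with `≥ 3` positive roots counted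
  with multiplicity has the NORMALISED window `|κr| − |κs| X^U₁ + |κu| X^(U₁+V) − |κv| X^(U₁+V+W)` with `≥ 3` positive roots counted with
  multiplicity (factor `C σ · X^er`, `σ = sign κr`);
* `window_four_three_le_countP_of_sharp` — the same for the window `(r,s,u,v)` of a sharp fewnomial (`window_four_countP_of_sharp`),
  with the multipliers supplied as hypotheses, plus the positivity of the four normalised coefficients;
* `window_four_three_le_countP_of_table` — the exponent-LIST form a kernel kill file instantiates (`E : List ℕ`, `hE`).

[folklore] Bookkeeping (Euler twists with multiplicity are in `…CensusSharpRows` / `…WindowFourRowMult`); elementary.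
-/

-- `Summit.ValiantsHypothesis.ValiantsHypothesis.…` repeats a component by the D-0017 layout
-- (single-conjunct summit), which the `dupNamespace` linter flags; the name is mandated.
set_option linter.dupNamespace false

namespace Summit.ValiantsHypothesis.ValiantsHypothesis.Theorems.LacunarySymmetroidMatrixDescartes.Census

open Polynomial Finset
open scoped BigOperators Polynomial

/-- **Normalisation of an alternating window.**  An alternating 4-nomial `κr X^er + κs X^es + κu X^eu + κv X^ev` (consecutive
coefficients of opposite signs, gaps `U₁, V, W` with `U₁ ≥ 1`) with at least three positive roots counted with multiplicity has the
normalised window `|κr| − |κs| X^U₁ + |κu| X^(U₁+V) − |κv| X^(U₁+V+W)` with at least three positive roots counted with multiplicity,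
and `|κr|, |κs|, |κu|, |κv| > 0`. [folklore] -/
theorem window_four_core_three_le_countP {κr κs κu κv : ℝ} {er es eu ev U₁ V W : ℕ}
    (hU₁ : er + U₁ = es) (hV : es + V = eu) (hW : eu + W = ev) (hU₁0 : 0 < U₁)
    (h3 : 3 ≤ ((C κr * X ^ er + C κs * X ^ es + C κu * X ^ eu + C κv * X ^ ev : ℝ[X]).roots.countP (fun x => 0 < x)))
    (hsg1 : κr * κs < 0) (hsg2 : κs * κu < 0) (hsg3 : κu * κv < 0) :
    3 ≤ ((C |κr| - C |κs| * X ^ U₁ + C |κu| * X ^ (U₁ + V) - C |κv| * X ^ (U₁ + V + W) : ℝ[X]).roots.countP (fun x => 0 < x))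
    ∧ 0 < |κr| ∧ 0 < |κs| ∧ 0 < |κu| ∧ 0 < |κv| := by
  have hκr0 : κr ≠ 0 := by intro h; rw [h, zero_mul] at hsg1; exact lt_irrefl 0 hsg1
  have hκs0 : κs ≠ 0 := by intro h; rw [h, mul_zero] at hsg1; exact lt_irrefl 0 hsg1
  have hκu0 : κu ≠ 0 := by intro h; rw [h, mul_zero] at hsg2; exact lt_irrefl 0 hsg2
  have hκv0 : κv ≠ 0 := by intro h; rw [h, mul_zero] at hsg3; exact lt_irrefl 0 hsg3
  have hAp : 0 < |κr| := abs_pos.mpr hκr0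
  have hBp : 0 < |κs| := abs_pos.mpr hκs0
  have hCp : 0 < |κu| := abs_pos.mpr hκu0
  have hEp : 0 < |κv| := abs_pos.mpr hκv0
  -- normal form: residual = C σ · X^er · g with g = |κr| − |κs| X^U₁ + |κu| X^(U₁+V) − |κv| X^(U₁+V+W), σ = sign κr
  obtain ⟨σ, hσ0, hσr, hσs, hσu, hσv⟩ : ∃ σ : ℝ, σ ≠ 0 ∧ κr = σ * |κr| ∧ κs = -(σ * |κs|) ∧ κu = σ * |κu|
      ∧ κv = -(σ * |κv|) := by
    rcases lt_or_gt_of_ne hκr0 with hr | hr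
    · have hs : 0 < κs := by nlinarith
      have hu : κu < 0 := by nlinarith
      have hv : 0 < κv := by nlinarith
      refine ⟨-1, by norm_num, ?_, ?_, ?_, ?_⟩
      · rw [abs_of_neg hr]; ring
      · rw [abs_of_pos hs]; ring
      · rw [abs_of_neg hu]; ring
      · rw [abs_of_pos hv]; ring
    · have hs : κs < 0 := by nlinarith
      have hu : 0 < κu := by nlinarith
      have hv : κv < 0 := by nlinarith
      refine ⟨1, by norm_num, ?_, ?_, ?_, ?_⟩
      · rw [abs_of_pos hr]; ring
      · rw [abs_of_neg hs]; ring
      · rw [abs_of_pos hu]; ring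
      · rw [abs_of_neg hv]; ring
  set g : ℝ[X] := C |κr| - C |κs| * X ^ U₁ + C |κu| * X ^ (U₁ + V) - C |κv| * X ^ (U₁ + V + W) with hgdef
  have hes : es = er + U₁ := hU₁.symm
  have heu : eu = er + (U₁ + V) := by omega
  have hev : ev = er + (U₁ + V + W) := by omega
  have hfac' : (C (σ * |κr|) * X ^ er + C (-(σ * |κs|)) * X ^ es + C (σ * |κu|) * X ^ eu + C (-(σ * |κv|)) * X ^ ev : ℝ[X])
      = C σ * X ^ er * g := by
    rw [hgdef, hes, heu, hev]
    simp only [map_neg, map_mul, pow_add]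
    ring
  have hfac : (C κr * X ^ er + C κs * X ^ es + C κu * X ^ eu + C κv * X ^ ev : ℝ[X]) = C σ * X ^ er * g := by
    rw [← hfac', ← hσr, ← hσs, ← hσu, ← hσv]
  have hg0 : g ≠ 0 := by
    intro h0
    have := congrArg (fun q : ℝ[X] => q.coeff 0) h0
    simp only [hgdef, coeff_sub, coeff_add, coeff_C_zero, coeff_C_mul, coeff_X_pow, coeff_zero] at this
    have h1 : (0 : ℕ) ≠ U₁ := by omega
    have h2 : (0 : ℕ) ≠ U₁ + V := by omega
    have h3' : (0 : ℕ) ≠ U₁ + V + W := by omega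
    simp only [h1, h2, h3', if_false, mul_zero, sub_zero, add_zero] at this
    exact hAp.ne' this
  have h3g : 3 ≤ g.roots.countP (fun x => 0 < x) := by
    rw [← countP_posRoots_C_mul_X_pow_mul hσ0 er hg0, ← hfac]; exact h3
  exact ⟨h3g, hAp, hBp, hCp, hEp⟩

/-- **BRIDGE: the normalised window of a sharp fewnomial.**  Let `Σ_{t<n} c_t X^{e_t}` (exponents strictly increasing on `range n`)
have at least `n − 1` positive roots counted with multiplicity, `r < s < u < v < n`, gaps `U₁ = e_s − e_r`, `V = e_u − e_s`,
`W = e_v − e_u`, and `M_t = |∏_{w<n, w∉{r,s,u,v}} (e_t − e_w)|` (supplied as hypotheses).  Then with `a = |c_r| M_r`, `b = |c_s| M_s`,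
`c = |c_u| M_u`, `e = |c_v| M_v` the pure window 4-nomial `a − bX^U₁ + cX^(U₁+V) − eX^(U₁+V+W)` has at least three positive roots
counted with multiplicity, and `a, b, c, e > 0` — so every pure-form window-4 row applies to it. [folklore] -/
theorem window_four_three_le_countP_of_sharp {n : ℕ} {e : ℕ → ℕ} {c : ℕ → ℝ} (he : ∀ i j, i < j → j < n → e i < e j)
    (hZ : n ≤ (∑ t ∈ range n, C (c t) * X ^ (e t) : ℝ[X]).roots.countP (fun x => 0 < x) + 1)
    {r s u v : ℕ} (hrs : r < s) (hsu : s < u) (huv : u < v) (hvn : v < n)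
    (U₁ V W : ℕ) (hU₁ : e r + U₁ = e s) (hV : e s + V = e u) (hW : e u + W = e v)
    (Mr Ms Mu Mv : ℝ)
    (hMr : |∏ w ∈ (range n).filter (fun w => ¬(w = r ∨ w = s ∨ w = u ∨ w = v)), ((e r : ℝ) - e w)| = Mr)
    (hMs : |∏ w ∈ (range n).filter (fun w => ¬(w = r ∨ w = s ∨ w = u ∨ w = v)), ((e s : ℝ) - e w)| = Ms)
    (hMu : |∏ w ∈ (range n).filter (fun w => ¬(w = r ∨ w = s ∨ w = u ∨ w = v)), ((e u : ℝ) - e w)| = Mu)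
    (hMv : |∏ w ∈ (range n).filter (fun w => ¬(w = r ∨ w = s ∨ w = u ∨ w = v)), ((e v : ℝ) - e w)| = Mv) :
    3 ≤ ((C (|c r| * Mr) - C (|c s| * Ms) * X ^ U₁ + C (|c u| * Mu) * X ^ (U₁ + V) - C (|c v| * Mv) * X ^ (U₁ + V + W)
          : ℝ[X]).roots.countP (fun x => 0 < x))
    ∧ 0 < |c r| * Mr ∧ 0 < |c s| * Ms ∧ 0 < |c u| * Mu ∧ 0 < |c v| * Mv := by
  have hU₁0 : 0 < U₁ := by have := he r s hrs (by omega); omega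
  obtain ⟨h3, hsg1, hsg2, hsg3⟩ := window_four_countP_of_sharp he hZ hrs hsu huv hvn
  rw [← hMr, ← hMs, ← hMu, ← hMv]
  simp only [← abs_mul]
  exact window_four_core_three_le_countP (V := V) (W := W) hU₁ hV hW hU₁0 h3 hsg1 hsg2 hsg3

/-- **BRIDGE, exponent-LIST form** (what a kernel kill file instantiates: the exponent table is a list `E` with `e t = E.getD t 0`,
gaps and absolute twist multipliers read off `E`). [folklore] -/
theorem window_four_three_le_countP_of_table {n : ℕ} {e : ℕ → ℕ} {c : ℕ → ℝ} (he : ∀ i j, i < j → j < n → e i < e j)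
    (hZ : n ≤ (∑ t ∈ range n, C (c t) * X ^ (e t) : ℝ[X]).roots.countP (fun x => 0 < x) + 1)
    (E : List ℕ) (hE : ∀ t, t < n → e t = E.getD t 0)
    {r s u v : ℕ} (hrs : r < s) (hsu : s < u) (huv : u < v) (hvn : v < n) (U₁ V W : ℕ)
    (hU₁ : E.getD r 0 + U₁ = E.getD s 0) (hV : E.getD s 0 + V = E.getD u 0) (hW : E.getD u 0 + W = E.getD v 0)
    (Mr Ms Mu Mv : ℝ)
    (hMr : |∏ w ∈ (range n).filter (fun w => ¬(w = r ∨ w = s ∨ w = u ∨ w = v)), (((E.getD r 0 : ℕ) : ℝ) - (E.getD w 0 : ℕ))| = Mr)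
    (hMs : |∏ w ∈ (range n).filter (fun w => ¬(w = r ∨ w = s ∨ w = u ∨ w = v)), (((E.getD s 0 : ℕ) : ℝ) - (E.getD w 0 : ℕ))| = Ms)
    (hMu : |∏ w ∈ (range n).filter (fun w => ¬(w = r ∨ w = s ∨ w = u ∨ w = v)), (((E.getD u 0 : ℕ) : ℝ) - (E.getD w 0 : ℕ))| = Mu)
    (hMv : |∏ w ∈ (range n).filter (fun w => ¬(w = r ∨ w = s ∨ w = u ∨ w = v)), (((E.getD v 0 : ℕ) : ℝ) - (E.getD w 0 : ℕ))| = Mv) :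
    3 ≤ ((C (|c r| * Mr) - C (|c s| * Ms) * X ^ U₁ + C (|c u| * Mu) * X ^ (U₁ + V) - C (|c v| * Mv) * X ^ (U₁ + V + W)
          : ℝ[X]).roots.countP (fun x => 0 < x))
    ∧ 0 < |c r| * Mr ∧ 0 < |c s| * Ms ∧ 0 < |c u| * Mu ∧ 0 < |c v| * Mv := by
  classical
  have hprod : ∀ t, t < n → (∏ w ∈ (range n).filter (fun w => ¬(w = r ∨ w = s ∨ w = u ∨ w = v)), ((e t : ℝ) - e w))
      = ∏ w ∈ (range n).filter (fun w => ¬(w = r ∨ w = s ∨ w = u ∨ w = v)), (((E.getD t 0 : ℕ) : ℝ) - (E.getD w 0 : ℕ)) := by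
    intro t ht
    refine Finset.prod_congr rfl fun w hw => ?_
    have hw' : w < n := mem_range.mp (mem_filter.mp hw).1
    rw [hE t ht, hE w hw']
  have hMr' : |∏ w ∈ (range n).filter (fun w => ¬(w = r ∨ w = s ∨ w = u ∨ w = v)), ((e r : ℝ) - e w)| = Mr := by
    rw [hprod r (by omega)]; exact hMr
  have hMs' : |∏ w ∈ (range n).filter (fun w => ¬(w = r ∨ w = s ∨ w = u ∨ w = v)), ((e s : ℝ) - e w)| = Ms := by
    rw [hprod s (by omega)]; exact hMs
  have hMu' : |∏ w ∈ (range n).filter (fun w => ¬(w = r ∨ w = s ∨ w = u ∨ w = v)), ((e u : ℝ) - e w)| = Mu := by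
    rw [hprod u (by omega)]; exact hMu
  have hMv' : |∏ w ∈ (range n).filter (fun w => ¬(w = r ∨ w = s ∨ w = u ∨ w = v)), ((e v : ℝ) - e w)| = Mv := by
    rw [hprod v hvn]; exact hMv
  have hU₁' : e r + U₁ = e s := by rw [hE r (by omega), hE s (by omega)]; exact hU₁
  have hV' : e s + V = e u := by rw [hE s (by omega), hE u (by omega)]; exact hV
  have hW' : e u + W = e v := by rw [hE u (by omega), hE v hvn]; exact hW
  exact window_four_three_le_countP_of_sharp he hZ hrs hsu huv hvn U₁ V W hU₁' hV' hW' Mr Ms Mu Mv hMr' hMs' hMu' hMv'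

end Summit.ValiantsHypothesis.ValiantsHypothesis.Theorems.LacunarySymmetroidMatrixDescartes.Census
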